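import Literature.NumberTheory.EllipticCurves.MatsunoCurves
import Literature.NumberTheory.EllipticCurves.KramerShaIsogeny
import HarnessLib

/-!
# Matsuno 2009, §5: the transport `Ш(A/K)[n] → Ш(B/K)[n]` discharged

`Proofs` companion of `Literature/NumberTheory/EllipticCurves/MatsunoCurves.lean`. That file vendors,
among the level-2 inputs of the proof of Matsuno's Theorem 5.1 (K. Matsuno, Math. Res. Lett. 16
(2009), §5), the named fact
`Literature.NumberTheory.EllipticCurves.Matsuno2009_shaTorsion_kramerCurveB_of_kramerCurveA`
(p. 459: "The isogeny `f : A → B` induces an isomorphism `Ш(A/K)[n] ≅ Ш(B/K)[n]` since the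
degree of `f` is prime to `n`", in the form: an embedded `(ℤ/n)^{⊕c}` in `Ш(A_m/K)[n]` yields
one in `Ш(B_m/K)[n]`, for Kramer's curves `A_m, B_m` over `ℚ` base-changed to a number field `K`,
`m ≥ 1`, `n` odd). It is PROVED here (`Matsuno2009_shaTorsion_kramerCurveB_of_kramerCurveA_holds`)
from `Literature/NumberTheory/EllipticCurves/KramerShaIsogeny.lean`, which constructs Kramer's
`2`-isogeny `A → A' → E₂(A') ≅ B` through explicit models and shows that `Ш(f)` is injective on
`Ш[n]` for every isogeny `f` admitting `g` with `g ∘ f = [d]`, `(n, d) = 1`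
(`exists_shaTorsion_injective_kramer_baseChange`).

## References

* K. Matsuno, Math. Res. Lett. 16 (2009), no. 3, 449–461, §5 (p. 459). [Matsuno2009]
* K. Kramer, Proc. Amer. Math. Soc. 89 (1983), 379–386, §5 (12). [Kramer1983]
-/

noncomputable section

open scoped Classical

open WeierstrassCurve

namespace Literature.NumberTheory.EllipticCurves

/-- **Discharge of `Matsuno2009_shaTorsion_kramerCurveB_of_kramerCurveA`** (Matsuno, p. 459:
`Ш(A/K)[n] ≅ Ш(B/K)[n]` along the `2`-isogeny for odd `n`, in the direction used): compose the
given embedding `(ℤ/n)^{⊕c} ↪ Ш(A_m/K)[n]` with the injection `Ш(A_m/K)[n] ↪ Ш(B_m/K)[n]` of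
`exists_shaTorsion_injective_kramer_baseChange` (Kramer's explicit `2`-isogeny, `(n, 2) = 1`).
[cite: Matsuno2009, §5 (p. 459, first sentence)] -/
theorem Matsuno2009_shaTorsion_kramerCurveB_of_kramerCurveA_holds :
    Matsuno2009_shaTorsion_kramerCurveB_of_kramerCurveA := by
  intro K _ _ m hm n hn c hA
  obtain ⟨f, hf⟩ := hA
  obtain ⟨F, hF⟩ := exists_shaTorsion_injective_kramer_baseChange K (Nat.pos_of_ne_zero hm) hn
  exact ⟨F.comp f, hF.comp hf⟩

end Literature.NumberTheory.EllipticCurves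

end
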